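import Summits.CriticalPhenomena.PercolationContinuityZ3.Theorems.PercNearOneGluingNoHeavyLowerTailThreePartitionRowColumn

/-!
# `NoHeavyLowerTail` (crux stmt-CriticalPhenomena-4575): Conjecture V holds when the two up-sets have
# DISJOINT SUPPORTS (the tight regime `Σκ = 0`) — three fibrewise Kleitman moves

Support file (lineage `prim-bnk-2`, generation 29, "THEOREM I"; `--supports stmt-CriticalPhenomena-4575`; memo
`run/shared/lean/prim/prim-l12/FROM-prim-bnk-2-g29-DECOUPLED-HALL.md` §2).  No `sorry`, standard axioms, no new definitions.

Conjecture V (`…ThreePartitionVOrder.VOrderPositivity`, OPEN) says that the kernel sum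
`vSumT τ 𝒱 𝒲 𝒳 = 2·#(a∈𝒱𝒲) + #(c∈𝒱, b∈𝒲) − #(a∈𝒲, c∈𝒱) − #(a∈𝒱, c∈𝒲) − #(c∈𝒱𝒲)` (counts of twisted
3-partitions with `(a,b) ∈ 𝒳`) is `≥ 0` for all up-sets `𝒱, 𝒲`, all twists and every up-set `𝒳` of the copy order.  It is known on
nested pairs (`…VOrderNested`, `…VOrderReverseNested`).

**Theorem (this file, `vSumT_nonneg_of_disjointSupports`).**  If for some set of coordinates `J` the family `𝒲` only depends on
the coordinates in `J` and `𝒱` only on the coordinates outside `J` (`w ∈ 𝒲 ↔ w ∩ J ∈ 𝒲`, `w ∈ 𝒱 ↔ w \ J ∈ 𝒱`), then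
`vSumT τ 𝒱 𝒲 𝒳 ≥ 0` for every twist and every up-set `𝒳` of the copy order.  (Here all the Kleitman slacks `κ_S(𝒱;𝒲)` vanish:
the tight regime of the programme, in which the `T3⁻` units must be matched onto `T3⁺` entirely — memo g24–g26.)

**Proof** — the five terms are matched by three moves, each an instance of the tree's fibrewise Harris/Kleitman:
`#(a∈𝒲, c∈𝒱) ≤ #(a∈𝒱𝒲)` and `#(a∈𝒱, c∈𝒲) ≤ #(a∈𝒱𝒲)` are column moves (`triT_col_le`, no hypothesis on the supports), and
`#(c∈𝒱, c∈𝒲) ≤ #(c∈𝒱, b∈𝒲)` (`triT_row_le_of_measurable`) moves the requirement `∈ 𝒲` from the third copy to the second INSIDE THE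
SUB-FIBRE OF THE `J`-COORDINATES of each row, on which the requirement `c ∈ 𝒱` is constant — this is where the disjointness of the
supports is used (`FoldingFibre.fibreCount_le_of_isUpperSet` on the folding fibre `(S₁ᶜ ∩ J, ·)`).  The third inequality holds for every
ROW-CLOSED family (row sections up-sets), which is recorded as stated. [this work]
-/

namespace Summit.CriticalPhenomena.PercolationContinuityZ3.Theorems.ThreePartition

open Finset Function
open scoped symmDiff Classical

noncomputable section

variable {ι : Type*} [Fintype ι]

/-! ## Splitting a count by a sub-fibre -/

omit [Fintype ι] in
/-- Pointwise description of the three set identities used on a sub-fibre `{b : b \ M' = u'}` with `M' = Sᶜ ∩ J`: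
membership in `b \ Sᶜ`, in `(b ∆ Sᶜ) \ J` and in `(b ∆ Sᶜ) ∩ J` is determined by `u'`, resp. by `b ∆ M'`. [this work] -/
theorem subfibre_identities {S J b u' : Set ι} (hb : b \ (Sᶜ ∩ J) = u') :
    b \ Sᶜ = u' \ Sᶜ ∧ (b ∆ Sᶜ) \ J = (u' \ J) ∆ (Sᶜ \ J) ∧ (b ∆ Sᶜ) ∩ J = (b ∆ (Sᶜ ∩ J)) ∩ J := by
  have hx : ∀ x, (x ∈ b ∧ ¬ (x ∉ S ∧ x ∈ J)) ↔ x ∈ u' := fun x => by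
    rw [← hb]; simp only [Set.mem_sdiff, Set.mem_inter_iff, Set.mem_compl_iff]
  refine ⟨?_, ?_, ?_⟩
  · ext x
    have h := hx x
    simp only [Set.mem_sdiff, Set.mem_compl_iff, not_not]
    tauto
  · ext x
    have h := hx x
    simp only [Set.mem_sdiff, Set.mem_symmDiff, Set.mem_compl_iff]
    tauto
  · ext x
    simp only [Set.mem_inter_iff, Set.mem_symmDiff, Set.mem_compl_iff]
    tauto

/-! ## The row move under disjoint supports -/

/-- **Row move under disjoint supports.**  Let `𝒲` be an up-set depending only on the coordinates in `J` and `𝒱` any family depending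
only on the coordinates outside `J`.  Then on every row-closed family (`b ∈ ℬ_a` with `ℬ_a` an up-set, for each first copy `a`)
the increasing requirement `∈ 𝒲` may be moved from the third copy `c` to the second copy `b` in the presence of the requirement
`c ∈ 𝒱`:  `#(b ∈ ℬ_a, c ∈ 𝒱, c ∈ 𝒲) ≤ #(b ∈ ℬ_a, c ∈ 𝒱, b ∈ 𝒲)` (twisted counts, every `τ`).  Proof: split each row fibre
`(S₁ᶜ, S₁ ∩ τ)` by the value of `b` off `M' = S₁ᶜ ∩ J`; on a sub-fibre `c ∈ 𝒱` and the spectator condition are constant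
(`subfibre_identities`) and `c ∈ 𝒲 ↔ b ∆ M' ∈ 𝒲`, so the inequality is `FoldingFibre.fibreCount_le_of_isUpperSet` on `(M', u')`.
Without the support hypothesis this is false (it is the row deficit of Conjecture V). [this work] -/
theorem triT_row_le_of_measurable (τ : Set ι) (ℬ : Set ι → Set (Set ι)) (hℬ : ∀ a, IsUpperSet (ℬ a))
    {𝒱 𝒲 : Set (Set ι)} (h𝒲 : IsUpperSet 𝒲) (J : Set ι) (h𝒲J : ∀ w : Set ι, w ∈ 𝒲 ↔ w ∩ J ∈ 𝒲)
    (h𝒱J : ∀ w : Set ι, w ∈ 𝒱 ↔ w \ J ∈ 𝒱) :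
    triT τ (fun a b c => b ∈ ℬ a ∧ c ∈ 𝒱 ∧ c ∈ 𝒲) ≤ triT τ (fun a b c => b ∈ ℬ a ∧ c ∈ 𝒱 ∧ b ∈ 𝒲) := by
  rw [triT_eq_sum_fst, triT_eq_sum_fst]
  refine sum_le_sum fun S _ => ?_
  set M' : Set ι := Sᶜ ∩ J with hM'
  -- split both fibre counts by `u' = b \ M'`
  have split : ∀ P : Set ι → Prop,
      (Finset.univ.filter fun b : Set ι => b \ Sᶜ = S ∩ τ ∧ P b).card =
        ∑ u' : Set ι, (Finset.univ.filter fun b : Set ι => b \ M' = u' ∧ (b \ Sᶜ = S ∩ τ ∧ P b)).card := by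
    intro P
    rw [card_eq_sum_card_fiberwise (f := fun b : Set ι => b \ M') (t := Finset.univ) (fun _ _ => mem_univ _)]
    refine sum_congr rfl fun u' _ => ?_
    congr 1
    ext b
    simp only [mem_filter, mem_univ, true_and]
    tauto
  rw [split (fun b => b ∈ ℬ (S ∆ τ) ∧ b ∆ Sᶜ ∈ 𝒱 ∧ b ∆ Sᶜ ∈ 𝒲),
    split (fun b => b ∈ ℬ (S ∆ τ) ∧ b ∆ Sᶜ ∈ 𝒱 ∧ b ∈ 𝒲)]
  refine sum_le_sum fun u' _ => ?_
  -- the conditions that are constant on the sub-fibre `(M', u')`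
  by_cases hconst : u' \ Sᶜ = S ∩ τ ∧ (u' \ J) ∆ (Sᶜ \ J) ∈ 𝒱
  · -- on this sub-fibre the counts are a fibrewise Kleitman pair
    have key := Literature.Probability.Percolation.FoldingFibre.fibreCount_le_of_isUpperSet (hℬ (S ∆ τ)) h𝒲 M' u'
    refine le_trans (le_of_eq (congrArg Finset.card ?_)) (le_trans key (le_of_eq (congrArg Finset.card ?_)))
    · ext b
      simp only [mem_filter, mem_univ, true_and]
      constructor
      · rintro ⟨hb, -, hB, -, hW⟩
        obtain ⟨_, _, i3⟩ := subfibre_identities (S := S) (J := J) hb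
        refine ⟨hb, hB, ?_⟩
        rw [h𝒲J, ← i3, ← h𝒲J]; exact hW
      · rintro ⟨hb, hB, hW⟩
        obtain ⟨i1, i2, i3⟩ := subfibre_identities (S := S) (J := J) hb
        refine ⟨hb, ?_, hB, ?_, ?_⟩
        · rw [i1]; exact hconst.1
        · rw [h𝒱J, i2]; exact hconst.2
        · rw [h𝒲J, i3, ← h𝒲J]; exact hW
    · ext b
      simp only [mem_filter, mem_univ, true_and, Set.mem_inter_iff, Set.mem_univ, and_true]
      constructor
      · rintro ⟨hb, hB, hW⟩
        obtain ⟨i1, i2, _⟩ := subfibre_identities (S := S) (J := J) hb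
        refine ⟨hb, ?_, hB, ?_, hW⟩
        · rw [i1]; exact hconst.1
        · rw [h𝒱J, i2]; exact hconst.2
      · rintro ⟨hb, -, hB, -, hW⟩
        exact ⟨hb, hB, hW⟩
  · -- off these conditions the left count vanishes
    refine le_trans (Finset.card_le_card (t := (∅ : Finset (Set ι))) fun b hb => ?_) (by simp)
    simp only [mem_filter, mem_univ, true_and] at hb
    obtain ⟨hb, hS, -, hV, -⟩ := hb
    obtain ⟨i1, i2, _⟩ := subfibre_identities (S := S) (J := J) hb
    refine absurd ⟨?_, ?_⟩ hconst
    · rw [← i1]; exact hS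
    · rw [← i2, ← h𝒱J]; exact hV

/-! ## Conjecture V under disjoint supports -/

/-- **CONJECTURE V HOLDS WHEN THE SUPPORTS ARE DISJOINT** ("THEOREM I" of the lineage): if `𝒲` depends only on the coordinates
in `J` and `𝒱` only on those outside `J`, then `vSumT τ 𝒱 𝒲 𝒳 ≥ 0` for every twist `τ` and every up-set `𝒳` of the copy order.
The five terms of `vSumT` are matched by two column moves (`#(a∈𝒲,c∈𝒱) ≤ #(a∈𝒱𝒲)`, `#(a∈𝒱,c∈𝒲) ≤ #(a∈𝒱𝒲)`, each using one of
the two units of the double term) and the row move `#(c∈𝒱𝒲) ≤ #(c∈𝒱, b∈𝒲)` of `triT_row_le_of_measurable`. [this work] -/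
theorem vSumT_nonneg_of_disjointSupports (τ : Set ι) {𝒱 𝒲 : Set (Set ι)} {𝒳 : Set (Set ι × Set ι)}
    (h𝒱 : IsUpperSet 𝒱) (h𝒲 : IsUpperSet 𝒲) (h𝒳 : IsUpperSet 𝒳) (J : Set ι)
    (h𝒲J : ∀ w : Set ι, w ∈ 𝒲 ↔ w ∩ J ∈ 𝒲) (h𝒱J : ∀ w : Set ι, w ∈ 𝒱 ↔ w \ J ∈ 𝒱) :
    0 ≤ vSumT τ 𝒱 𝒲 𝒳 := by
  -- column move for `𝒱` on the sections `{a : (a,b) ∈ 𝒳, a ∈ 𝒲}`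
  have hA1 : ∀ b : Set ι, IsUpperSet {a : Set ι | (a, b) ∈ 𝒳 ∧ a ∈ 𝒲} :=
    fun b a a' hle ha => ⟨h𝒳 (Prod.mk_le_mk.2 ⟨hle, le_rfl⟩) ha.1, h𝒲 hle ha.2⟩
  have m1 := triT_col_le τ (fun b => {a : Set ι | (a, b) ∈ 𝒳 ∧ a ∈ 𝒲}) hA1 h𝒱
  have m1' : triT τ (fun a b c => (a, b) ∈ 𝒳 ∧ a ∈ 𝒲 ∧ c ∈ 𝒱) ≤ triT τ (fun a b _ => (a, b) ∈ 𝒳 ∧ a ∈ 𝒱 ∧ a ∈ 𝒲) := by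
    refine le_trans (le_of_eq (triT_congr fun a b c => ?_)) (le_trans m1 (le_of_eq (triT_congr fun a b c => ?_)))
    · simp only [Set.mem_setOf_eq]; tauto
    · simp only [Set.mem_setOf_eq]; tauto
  -- column move for `𝒲` on the sections `{a : (a,b) ∈ 𝒳, a ∈ 𝒱}`
  have hA2 : ∀ b : Set ι, IsUpperSet {a : Set ι | (a, b) ∈ 𝒳 ∧ a ∈ 𝒱} :=
    fun b a a' hle ha => ⟨h𝒳 (Prod.mk_le_mk.2 ⟨hle, le_rfl⟩) ha.1, h𝒱 hle ha.2⟩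
  have m2 := triT_col_le τ (fun b => {a : Set ι | (a, b) ∈ 𝒳 ∧ a ∈ 𝒱}) hA2 h𝒲
  have m2' : triT τ (fun a b c => (a, b) ∈ 𝒳 ∧ a ∈ 𝒱 ∧ c ∈ 𝒲) ≤ triT τ (fun a b _ => (a, b) ∈ 𝒳 ∧ a ∈ 𝒱 ∧ a ∈ 𝒲) := by
    refine le_trans (le_of_eq (triT_congr fun a b c => ?_)) (le_trans m2 (le_of_eq (triT_congr fun a b c => ?_)))
    · simp only [Set.mem_setOf_eq]; tauto
    · simp only [Set.mem_setOf_eq]; tauto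
  -- row move for `𝒲` in the presence of `c ∈ 𝒱`, on the row sections `{b : (a,b) ∈ 𝒳}`
  have hB : ∀ a : Set ι, IsUpperSet {b : Set ι | (a, b) ∈ 𝒳} :=
    fun a b b' hle hb => h𝒳 (Prod.mk_le_mk.2 ⟨le_rfl, hle⟩) hb
  have m3 := triT_row_le_of_measurable τ (fun a => {b : Set ι | (a, b) ∈ 𝒳}) hB h𝒲 J h𝒲J h𝒱J
  have m3' : triT τ (fun a b c => (a, b) ∈ 𝒳 ∧ c ∈ 𝒱 ∧ c ∈ 𝒲) ≤ triT τ (fun a b c => (a, b) ∈ 𝒳 ∧ c ∈ 𝒱 ∧ b ∈ 𝒲) := by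
    refine le_trans (le_of_eq (triT_congr fun a b c => ?_)) (le_trans m3 (le_of_eq (triT_congr fun a b c => ?_)))
    · simp only [Set.mem_setOf_eq]
    · simp only [Set.mem_setOf_eq]
  unfold vSumT
  have h1 := Int.ofNat_le.2 m1'
  have h2 := Int.ofNat_le.2 m2'
  have h3 := Int.ofNat_le.2 m3'
  push_cast
  linarith

/-- **The three-partition functional under disjoint supports**: `threePartNT τ 𝒰 𝒱 𝒲 ≥ 0` for every up-set `𝒰` when `𝒱, 𝒲`
have disjoint supports (cylinder `𝒳 = {a ∈ 𝒰}`). [this work] -/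
theorem threePartNT_nonneg_of_disjointSupports (τ : Set ι) {𝒰 𝒱 𝒲 : Set (Set ι)} (h𝒰 : IsUpperSet 𝒰)
    (h𝒱 : IsUpperSet 𝒱) (h𝒲 : IsUpperSet 𝒲) (J : Set ι)
    (h𝒲J : ∀ w : Set ι, w ∈ 𝒲 ↔ w ∩ J ∈ 𝒲) (h𝒱J : ∀ w : Set ι, w ∈ 𝒱 ↔ w \ J ∈ 𝒱) :
    0 ≤ threePartNT τ 𝒰 𝒱 𝒲 := by
  rw [← vSumT_fst_eq_threePartNT]
  exact vSumT_nonneg_of_disjointSupports τ h𝒱 h𝒲 (isUpperSet_fst_mem h𝒰) J h𝒲J h𝒱J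

end

end Summit.CriticalPhenomena.PercolationContinuityZ3.Theorems.ThreePartition
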